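import Summits.Ventures.AbcShadow.SH04.StatementBD13_11
import Summits.Ventures.AbcShadow.SH04.Level650
import Summits.Ventures.AbcShadow.SH04.Level2600
import Summits.Ventures.AbcShadow.SH04.Level5200a
import Summits.Ventures.AbcShadow.SH04.Level5200b

/-!
# Venture AbcShadow — ROW SH-04 `[BD10] (13, 11)`: `x⁵ + y⁵ = 13 z¹¹` (the reduction theorem)

HONEST FRAMING. A row of the work-bound cell `abc-shadow` (typer seat `abc-shadow-typ-1`, lineage g2): a CONDITIONAL,
typed/kernel-checked REDUCTION, no claim on abc or on any summit, no side on IUT. `sh04_bd13_11_of` derives the target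
`SH04BD13_11` (`SH04/StatementBD13_11.lean`) from EXACTLY these hypotheses on an arbitrary model `M : NewformModel` of the
AbcSig interface (meaningful for the intended model only, see `SH04/BD10Package.lean`):

* `hP : BD10Package13 M` — CITED print package [BD10, §1 + Prop 1.1 + §2; the level set `{650, 2600, 5200}` and weight 2 from
  [Bil07] as cited in BD10 §3.3];
* `hD650 : M.DataComplete 650 level650Orbits`, `hD2600 : … 2600 …`, `hD5200 : M.DataComplete 5200 (level5200OrbitsA ++
  level5200OrbitsB)` — COMPUTED: the newform data of `S₂^new(Γ₀(N))`, `N = 650, 2600, 5200` (15 + 29 + 66 = 110 Galois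
  orbits), transcribed in `SH04/Level{650,2600,5200a,5200b}.lean` from the cell's certificate 4a36c28685fe0350 (eng-2 j313661
  part D; the (13,11) closure re-derived by the blind referees ref-1 j315352 and ref-2 j314992/j315909 on disjoint code paths).

NO other input: no CM case arises in print's method for `d = 13` and none is needed here; the Frey-trace sets `A_q` are
COMPUTED IN THE KERNEL (`bdFreyTraces`, agreeing with the seven printed lists, `bdFreyTraces_printed`), including the two
non-printed ones `A_{31}`, `A_{41}` used for 7 of the 110 orbits (`bd10AllowedTab_spec_31/_41`). Everything else is PROVED
here, in the kernel: instantiation of the package at `p = 11` (prime, `≥ 7`, `≠ 13`), the passage `S_q ⊆ bd10AllowedTab q`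
(`arisesMod_mono`), and the [Prop 1.1] SIEVE at `p = 11` for all 110 orbits (mod-11 prime-ideal trees, `decide +kernel`, kill
primes `q = 3` (77 orbits), `7` (20), `17` (6), `31` (5), `41` (2)). In print: [BD10, Thm 3.3] for `p ≥ 19` only. Words for this
row: typed/kernel-checked REDUCTION; the newform data is COMPUTED (certificate 4a36c28685fe0350) and enters as the hypothesis
`DataComplete`; print inputs are NAMED hypotheses; adjacent, NOT abc; no side on IUT. AI-typed; weaker than expert refereeing.
-/

namespace Summit.Ventures.AbcShadow

open Summit.Ventures.AbcSig (NewformModel OrbitData)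

/-- Bookkeeping [cite: BillereyDieulefait2010, §1 p.1 (conventions)]: the target says exactly "no `IsBD10Solution 13 11`". -/
theorem sh04BD13_11_iff : SH04BD13_11 ↔ ∀ a b c : ℤ, ¬ IsBD10Solution 13 11 a b c := by
  constructor
  · rintro h a b c ⟨heq, hab, hc⟩
    exact h a b c hab hc (by simpa using heq)
  · intro h a b c hab hc heq
    exact h a b c ⟨by simpa using heq, hab, hc⟩

/-- **Row SH-04 `[BD10] (13, 11)` (reduction theorem).** Under the named hypotheses (module docstring) — the cited [BD10]
package for `d = 13` and the COMPUTED newform data of levels `650, 2600, 5200` (`DataComplete`) — the equation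
`x⁵ + y⁵ = 13 z¹¹` has no non-trivial primitive solution, i.e. `SH04BD13_11`. CASE TREE: the package at `p = 11` gives a newform
`f` at one of the three levels with the [Prop 1.1] congruences for the sets `S_q`; `S_q ⊆ bd10AllowedTab q`; `DataComplete`
puts `f` in one of the 110 transcribed orbits; every orbit is killed by its kernel-checked mod-11 tree. ADJACENT, NOT abc.
[cite: BillereyDieulefait2010, Thm 3.3 (printed for p ≥ 19; here p = 11, conditionally on the named inputs), Prop 1.1] -/
theorem sh04_bd13_11_of (M : NewformModel) (hP : BD10Package13 M)
    (hD650 : M.DataComplete 650 level650Orbits) (hD2600 : M.DataComplete 2600 level2600Orbits)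
    (hD5200 : M.DataComplete 5200 (level5200OrbitsA ++ level5200OrbitsB)) : SH04BD13_11 := by
  rw [sh04BD13_11_iff]
  intro a b c hsol
  obtain ⟨N, hN, f, hmod⟩ := hP 11 a b c (by norm_num) (by norm_num) (by norm_num) hsol
  have hmod' : M.ArisesMod f 11 bd10AllowedTab :=
    arisesMod_mono M f 11 bd10AllowedSpec bd10AllowedTab bd10AllowedTab_spec hmod
  rcases hN with rfl | rfl | rfl
  · obtain ⟨o, ho, hfo⟩ := hD650 f
    exact M.not_arisesMod_of_eliminated f o hfo 11 bd10AllowedTab (level650Orbits_elim11 o ho)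
      (level650Orbits_wellformed o ho) hmod'
  · obtain ⟨o, ho, hfo⟩ := hD2600 f
    exact M.not_arisesMod_of_eliminated f o hfo 11 bd10AllowedTab (level2600Orbits_elim11 o ho)
      (level2600Orbits_wellformed o ho) hmod'
  · obtain ⟨o, ho, hfo⟩ := hD5200 f
    rcases List.mem_append.mp ho with ho | ho
    · exact M.not_arisesMod_of_eliminated f o hfo 11 bd10AllowedTab (level5200OrbitsA_elim11 o ho)
        (level5200OrbitsA_wellformed o ho) hmod'
    · exact M.not_arisesMod_of_eliminated f o hfo 11 bd10AllowedTab (level5200OrbitsB_elim11 o ho)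
        (level5200OrbitsB_wellformed o ho) hmod'

end Summit.Ventures.AbcShadow
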